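import Summits.NavierStokesRegularity.OSWSelfSimilar.SheetREvenPairUniqueness
import Summits.NavierStokesRegularity.OSWSelfSimilar.SheetRComplexPivot
import HarnessLib

/-!
# SHEET-ℝ frame, EVEN ZERO-MASS class `E⁺₀` — dictionary layer 5b: THE EVEN PERTURBED RESOLVENT `R⁺_K(σ) : L²_w(ℂ) →L[ℂ] L²_w(ℂ)` of
# `(−∂² + d∂ + V) + K` on the even zero-mass energy class — existence, uniqueness, `ℂ`-linearity, weak meaning, and the SHARP bound
# `‖R⁺_K(σ)G‖ ≤ ‖G‖/(m + Re σ)`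

HONEST FRAMING (cell ns-blowup GROUP B / zone Z3, case Z3-SR-SPEC EVEN half; 1-D MODEL certificate frame (viscous gCLM/OSW sheet on the
line); not Euler/NS; «violates: none — MODEL»).  Nothing here asserts that a profile exists; the (S1⁺) datum `GardingDataKE` is the HYPOTHESIS
(for the even half of the certificate: `K = −P_nice + a·Ω̄′⊗ℓ̃ + F⁺`, DESIGN-Z3-SR-SPEC-EVEN §5.1/(D4); `m = c₁ + γ`, `c = c₂`).
Twin of `SheetRPerturbedResolventC` (+ the bound of `SheetRPerturbedResolventBounds`) on `E⁺₀`: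

* `pairOpKE σ` (`Re σ > −m`) — the pair solution operator of the realified shifted perturbed system (by choice from
  `SheetREvenPairOperator.exists_pairSolutionOperatorKE`), `pairOpKE_unique` (every energy-space pair solution on zero-mass even tests IS it —
  `SheetREvenPairUniqueness.pair_eq_zero_of_weakKE`), `pairOpKE_rot` (realified `ℂ`-linearity);
* `resolventKE σ : Wc L →L[ℂ] Wc L` — `ofPair ∘ ιpairE ∘ pairOpKE σ ∘ toPair` packaged as a `ℂ`-linear operator (`toComplexCLM`), `0` outside
  the half-plane; `resolventKE_weak` (its real/imaginary parts are the profiles of the pair solution, a.e., and solve the system with data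
  `(Re G, Im G)`); **`norm_resolventKE_le_inv`**: `‖R⁺_K(σ)G‖ ≤ ‖G‖/(m + Re σ)` (`SheetREvenPairUniqueness.pair_pivot_le`).
KERNEL CAVEAT (as for the odd `resolventKC`): the weak formulation tests against ZERO-MASS EVEN functions, so `R⁺_K(σ)` annihilates data
`w`-orthogonal to them (odd functions and the direction `w⁻¹`); it is THE resolvent on the even zero-mass class (next files).
Two definitions (`pairOpKE`, `resolventKE` with its `ℝ`-linear avatar); no named fact.  WHAT THIS IS NOT: not NS.
-/

noncomputable section

namespace Summit.NavierStokesRegularity.OSWSelfSimilar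
namespace SheetREvenResolvent

open _root_.MeasureTheory _root_.Set _root_.Filter _root_.Real SheetRWeakProfilePV SheetRWeakToStrong SheetREnergyClass SheetRWeightedMeasure
  SheetRLinearisedTests SheetREnergySpace SheetRTestSpace SheetRLinearisedFormBounds SheetREvenTests SheetREvenEnergySpace SheetREvenForms
  SheetREvenPairOperator SheetREvenPairUniqueness SheetRComplexPivot
open scoped Topology ENNReal

variable {L D₀ D₁ V₀ c m : ℝ} {d V : ℝ → ℝ}

/-! ### §1 The pair solution operator at `σ` and its uniqueness -/

/-- **The even perturbed pair solution operator** at `σ` (`Re σ > −m`), by choice. [folklore] -/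
def pairOpKE (hL : 0 < L) (K : EspE L hL →L[ℝ] W L) (h : GardingDataKE L hL d V K D₀ D₁ V₀ c m) (σ : ℂ) (hσ : -m < σ.re) :
    WithLp 2 (W L × W L) →L[ℝ] WithLp 2 (EspE L hL × EspE L hL) :=
  Classical.choose (exists_pairSolutionOperatorKE h hσ σ.im)

/-- The defining property of `pairOpKE`: the perturbed weak pair system on zero-mass even tests (potential `V + Re σ`, coupling `Im σ`) and
the bound `‖pairOpKE σ G‖ ≤ (4/κ_c(σ))‖G‖`. [folklore] -/
theorem pairOpKE_spec (hL : 0 < L) (K : EspE L hL →L[ℝ] W L) (h : GardingDataKE L hL d V K D₀ D₁ V₀ c m) (σ : ℂ) (hσ : -m < σ.re) :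
    (∀ (G : WithLp 2 (W L × W L)) (v v₁ : ℝ → ℝ), IsCompactTestE v v₁ → ∫ y, v y = 0 →
        linForm L d (fun ξ => V ξ + σ.re) (profile (pairOpKE hL K h σ hσ G).fst) (derE (pairOpKE hL K h σ hσ G).fst) v v₁
              + (∫ y, (L ^ 2 + y ^ 2) * (((K (pairOpKE hL K h σ hσ G).fst : W L) : ℝ → ℝ) y * v y))
              - σ.im * ∫ y, (L ^ 2 + y ^ 2) * (profile (pairOpKE hL K h σ hσ G).snd y * v y) =
            ∫ y, (L ^ 2 + y ^ 2) * ((G.fst : ℝ → ℝ) y * v y) ∧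
          linForm L d (fun ξ => V ξ + σ.re) (profile (pairOpKE hL K h σ hσ G).snd) (derE (pairOpKE hL K h σ hσ G).snd) v v₁
              + (∫ y, (L ^ 2 + y ^ 2) * (((K (pairOpKE hL K h σ hσ G).snd : W L) : ℝ → ℝ) y * v y))
              + σ.im * ∫ y, (L ^ 2 + y ^ 2) * (profile (pairOpKE hL K h σ hσ G).fst y * v y) =
            ∫ y, (L ^ 2 + y ^ 2) * ((G.snd : ℝ → ℝ) y * v y)) ∧
      ∀ G : WithLp 2 (W L × W L), ‖pairOpKE hL K h σ hσ G‖ ≤ 4 / min c (4 * (m + σ.re)) * ‖G‖ :=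
  Classical.choose_spec (exists_pairSolutionOperatorKE h hσ σ.im)

/-- **Uniqueness**: an energy-space pair solving the perturbed `σ`-system weakly on zero-mass even tests with data `G` IS `pairOpKE σ G`.
[folklore] -/
theorem pairOpKE_unique (hL : 0 < L) (K : EspE L hL →L[ℝ] W L) (h : GardingDataKE L hL d V K D₀ D₁ V₀ c m) (σ : ℂ) (hσ : -m < σ.re)
    (G : WithLp 2 (W L × W L)) {Q : WithLp 2 (EspE L hL × EspE L hL)}
    (hQ : ∀ v v₁ : ℝ → ℝ, IsCompactTestE v v₁ → ∫ y, v y = 0 →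
      linForm L d (fun ξ => V ξ + σ.re) (profile Q.fst) (derE Q.fst) v v₁
            + (∫ y, (L ^ 2 + y ^ 2) * (((K Q.fst : W L) : ℝ → ℝ) y * v y))
            - σ.im * ∫ y, (L ^ 2 + y ^ 2) * (profile Q.snd y * v y) = ∫ y, (L ^ 2 + y ^ 2) * ((G.fst : ℝ → ℝ) y * v y) ∧
        linForm L d (fun ξ => V ξ + σ.re) (profile Q.snd) (derE Q.snd) v v₁
            + (∫ y, (L ^ 2 + y ^ 2) * (((K Q.snd : W L) : ℝ → ℝ) y * v y))
            + σ.im * ∫ y, (L ^ 2 + y ^ 2) * (profile Q.fst y * v y) = ∫ y, (L ^ 2 + y ^ 2) * ((G.snd : ℝ → ℝ) y * v y)) :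
    Q = pairOpKE hL K h σ hσ G := by
  set P := pairOpKE hL K h σ hσ G with hP
  have hPs := (pairOpKE_spec hL K h σ hσ).1 G
  obtain ⟨hVs, hVb⟩ := shift_hypsE h σ.re
  -- the left-hand sides as bundled maps
  have key : ∀ (p q : EspE L hL) (v v₁ : ℝ → ℝ) (hv : IsCompactTestE v v₁) (h0 : ∫ y, v y = 0) (t : ℝ),
      linForm L d (fun ξ => V ξ + σ.re) (profile p) (derE p) v v₁ + (∫ y, (L ^ 2 + y ^ 2) * (((K p : W L) : ℝ → ℝ) y * v y))
        + t * ∫ y, (L ^ 2 + y ^ 2) * (profile q y * v y) =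
      EformE hL h.d_meas hVs h.D₁_nonneg h.d_le hVb p ⟨(v, v₁), hv, h0⟩ + PdataE hL (K p) ⟨(v, v₁), hv, h0⟩
        + t * BcplE hL q ⟨(v, v₁), hv, h0⟩ := by
    intro p q v v₁ hv h0 t; rw [EformE_apply, PdataE_apply, BcplE_apply]
  -- the difference solves the homogeneous system
  have hzero := pair_eq_zero_of_weakKE h hσ σ.im (Q - P) fun v v₁ hv h0 => ?_
  · exact sub_eq_zero.1 hzero
  have e1 := (hQ v v₁ hv h0).1
  have e2 := (hPs v v₁ hv h0).1
  have e3 := (hQ v v₁ hv h0).2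
  have e4 := (hPs v v₁ hv h0).2
  have hm1 : ∀ (p q : EspE L hL), linForm L d (fun ξ => V ξ + σ.re) (profile p) (derE p) v v₁
      + (∫ y, (L ^ 2 + y ^ 2) * (((K p : W L) : ℝ → ℝ) y * v y)) - σ.im * ∫ y, (L ^ 2 + y ^ 2) * (profile q y * v y) =
      EformE hL h.d_meas hVs h.D₁_nonneg h.d_le hVb p ⟨(v, v₁), hv, h0⟩ + PdataE hL (K p) ⟨(v, v₁), hv, h0⟩
        + (-σ.im) * BcplE hL q ⟨(v, v₁), hv, h0⟩ := by
    intro p q; rw [← key p q v v₁ hv h0 (-σ.im)]; ring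
  rw [hm1] at e1 e2 ⊢
  rw [key _ _ v v₁ hv h0] at e3 e4 ⊢
  rw [WithLp.sub_fst, WithLp.sub_snd, map_sub K, LinearMap.map_sub₂, LinearMap.map_sub₂, LinearMap.map_sub₂]
  rw [map_sub K, LinearMap.map_sub₂, LinearMap.map_sub₂, LinearMap.map_sub₂]
  constructor <;> linarith

/-- `derE` and `profile` of a negated element. [folklore] -/
theorem derE_neg (hL : 0 < L) (q : EspE L hL) :
    (derE (-q) =ᵐ[volume] fun y => -1 * derE q y) ∧ profile (-q) = fun x => -1 * profile q x := by
  have e : -q = (-1 : ℝ) • q := (neg_one_smul ℝ q).symm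
  rw [e]
  exact derE_smul hL (-1) q

/-- **Rotation**: `pairOpKE σ (−g_I, g_R) = (−p_I, p_R)` — realified `ℂ`-linearity. [folklore] -/
theorem pairOpKE_rot (hL : 0 < L) (K : EspE L hL →L[ℝ] W L) (h : GardingDataKE L hL d V K D₀ D₁ V₀ c m) (σ : ℂ) (hσ : -m < σ.re)
    (G : WithLp 2 (W L × W L)) :
    pairOpKE hL K h σ hσ (WithLp.toLp 2 (-G.snd, G.fst)) = WithLp.toLp 2 (-(pairOpKE hL K h σ hσ G).snd, (pairOpKE hL K h σ hσ G).fst) := by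
  set Q := pairOpKE hL K h σ hσ G with hQdef
  have hQ := (pairOpKE_spec hL K h σ hσ).1 G
  symm
  refine pairOpKE_unique hL K h σ hσ _ fun v v₁ hv h0 => ?_
  obtain ⟨e1, e2⟩ := hQ v v₁ hv h0
  have hR1 : (WithLp.toLp 2 (-Q.snd, Q.fst) : WithLp 2 (EspE L hL × EspE L hL)).fst = -Q.snd := rfl
  have hR2 : (WithLp.toLp 2 (-Q.snd, Q.fst) : WithLp 2 (EspE L hL × EspE L hL)).snd = Q.fst := rfl
  have hD1 : (WithLp.toLp 2 (-G.snd, G.fst) : WithLp 2 (W L × W L)).fst = -G.snd := rfl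
  have hD2 : (WithLp.toLp 2 (-G.snd, G.fst) : WithLp 2 (W L × W L)).snd = G.fst := rfl
  rw [hR1, hR2, hD1, hD2]
  obtain ⟨hneg_ae, hneg_prof⟩ := derE_neg hL Q.snd
  have hlin : linForm L d (fun ξ => V ξ + σ.re) (profile (-Q.snd)) (derE (-Q.snd)) v v₁ =
      -1 * linForm L d (fun ξ => V ξ + σ.re) (profile Q.snd) (derE Q.snd) v v₁ := by
    rw [linForm_congr_ae L d _ (Eventually.of_forall fun y => congrFun hneg_prof y) hneg_ae]
    exact linForm_smul_left L d _ (-1)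
  have hcpl : ∫ y, (L ^ 2 + y ^ 2) * (profile (-Q.snd) y * v y) = -1 * ∫ y, (L ^ 2 + y ^ 2) * (profile Q.snd y * v y) := by
    rw [← integral_const_mul]
    refine integral_congr_ae (Eventually.of_forall fun y => ?_)
    show (L ^ 2 + y ^ 2) * (profile (-Q.snd) y * v y) = -1 * ((L ^ 2 + y ^ 2) * (profile Q.snd y * v y))
    rw [congrFun hneg_prof y]; ring
  have hdat : ∫ y, (L ^ 2 + y ^ 2) * ((((-G.snd : W L)) : ℝ → ℝ) y * v y) = -1 * ∫ y, (L ^ 2 + y ^ 2) * ((G.snd : ℝ → ℝ) y * v y) := by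
    rw [← integral_const_mul]
    refine integral_congr_ae ((ae_volume_of_ae_μw hL (Lp.coeFn_neg (G.snd : W L))).mono fun y hy => ?_)
    show (L ^ 2 + y ^ 2) * (((-G.snd : W L) : ℝ → ℝ) y * v y) = -1 * ((L ^ 2 + y ^ 2) * ((G.snd : ℝ → ℝ) y * v y))
    rw [hy, Pi.neg_apply]; ring
  have hK : ∫ y, (L ^ 2 + y ^ 2) * (((K (-Q.snd) : W L) : ℝ → ℝ) y * v y) = -1 * ∫ y, (L ^ 2 + y ^ 2) * (((K Q.snd : W L) : ℝ → ℝ) y * v y) := by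
    rw [← integral_const_mul, map_neg K]
    refine integral_congr_ae ((ae_volume_of_ae_μw hL (Lp.coeFn_neg (K Q.snd : W L))).mono fun y hy => ?_)
    show (L ^ 2 + y ^ 2) * (((-(K Q.snd) : W L) : ℝ → ℝ) y * v y) = -1 * ((L ^ 2 + y ^ 2) * (((K Q.snd : W L) : ℝ → ℝ) y * v y))
    rw [hy, Pi.neg_apply]; ring
  refine ⟨?_, ?_⟩
  · rw [hlin, hK, hdat]; linarith
  · rw [hcpl]; linarith

/-! ### §2 The even perturbed resolvent on the complex pivot space -/

/-- The `ℝ`-linear even perturbed resolvent (`0` outside `Re σ > −m`). [folklore] -/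
def resolventRKE (hL : 0 < L) (K : EspE L hL →L[ℝ] W L) (h : GardingDataKE L hL d V K D₀ D₁ V₀ c m) (σ : ℂ) : Wc L →L[ℝ] Wc L :=
  if hσ : -m < σ.re then (ofPair L).comp ((ιpairE hL).comp ((pairOpKE hL K h σ hσ).comp (toPair L))) else 0

/-- Formula for `resolventRKE` inside the half-plane. [folklore] -/
theorem resolventRKE_apply (hL : 0 < L) (K : EspE L hL →L[ℝ] W L) (h : GardingDataKE L hL d V K D₀ D₁ V₀ c m) {σ : ℂ} (hσ : -m < σ.re)
    (G : Wc L) : resolventRKE hL K h σ G = ofPair L (ιpairE hL (pairOpKE hL K h σ hσ (toPair L G))) := by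
  rw [resolventRKE, dif_pos hσ]; rfl

/-- `resolventRKE σ = 0` outside the half-plane. [folklore] -/
theorem resolventRKE_of_not (hL : 0 < L) (K : EspE L hL →L[ℝ] W L) (h : GardingDataKE L hL d V K D₀ D₁ V₀ c m) {σ : ℂ} (hσ : ¬ -m < σ.re) :
    resolventRKE hL K h σ = 0 := by
  rw [resolventRKE, dif_neg hσ]

/-- Components of `ιpairE` of a rotated pair. [folklore] -/
theorem ιpairE_rot (hL : 0 < L) (Q : WithLp 2 (EspE L hL × EspE L hL)) :
    ιpairE hL (WithLp.toLp 2 (-Q.snd, Q.fst)) = WithLp.toLp 2 (-(ιpairE hL Q).snd, (ιpairE hL Q).fst) := by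
  obtain ⟨h1, h2⟩ := ιpairE_fst_snd hL Q
  obtain ⟨h1', h2'⟩ := ιpairE_fst_snd hL (WithLp.toLp 2 (-Q.snd, Q.fst) : WithLp 2 (EspE L hL × EspE L hL))
  refine WithLp.ofLp_injective 2 (Prod.ext ?_ ?_)
  · show (ιpairE hL (WithLp.toLp 2 (-Q.snd, Q.fst))).fst = -(ιpairE hL Q).snd
    rw [h1', h2]; exact map_neg (ιEE hL) Q.snd
  · show (ιpairE hL (WithLp.toLp 2 (-Q.snd, Q.fst))).snd = (ιpairE hL Q).fst
    rw [h2', h1]; rfl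

/-- `resolventRKE σ` commutes with multiplication by `i`. [folklore] -/
theorem resolventRKE_I_smul (hL : 0 < L) (K : EspE L hL →L[ℝ] W L) (h : GardingDataKE L hL d V K D₀ D₁ V₀ c m) (σ : ℂ) (G : Wc L) :
    resolventRKE hL K h σ ((Complex.I : ℂ) • G) = (Complex.I : ℂ) • resolventRKE hL K h σ G := by
  by_cases hσ : -m < σ.re
  · rw [resolventRKE_apply hL K h hσ, resolventRKE_apply hL K h hσ]
    have hrot : toPair L ((Complex.I : ℂ) • G) = WithLp.toLp 2 (-(toPair L G).snd, (toPair L G).fst) :=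
      WithLp.ofLp_injective 2 (Prod.ext (toPair_I_smul G).1 (toPair_I_smul G).2)
    rw [hrot, pairOpKE_rot hL K h σ hσ, ιpairE_rot, ofPair_rot]
  · rw [resolventRKE_of_not hL K h hσ]; simp

/-- **THE EVEN PERTURBED RESOLVENT** `R⁺_K(σ) : L²_w(ℂ) →L[ℂ] L²_w(ℂ)` (`ℂ`-linear; `0` outside `Re σ > −m`). [folklore] -/
def resolventKE (hL : 0 < L) (K : EspE L hL →L[ℝ] W L) (h : GardingDataKE L hL d V K D₀ D₁ V₀ c m) (σ : ℂ) : Wc L →L[ℂ] Wc L :=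
  toComplexCLM (resolventRKE hL K h σ) (resolventRKE_I_smul hL K h σ)

/-- `resolventKE σ` acts as `resolventRKE σ`. [folklore] -/
theorem resolventKE_apply (hL : 0 < L) (K : EspE L hL →L[ℝ] W L) (h : GardingDataKE L hL d V K D₀ D₁ V₀ c m) (σ : ℂ) (G : Wc L) :
    resolventKE hL K h σ G = resolventRKE hL K h σ G := rfl

/-- `resolventKE σ = 0` outside the half-plane. [folklore] -/
theorem resolventKE_of_not (hL : 0 < L) (K : EspE L hL →L[ℝ] W L) (h : GardingDataKE L hL d V K D₀ D₁ V₀ c m) {σ : ℂ}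
    (hσ : ¬ -m < σ.re) (G : Wc L) : resolventKE hL K h σ G = 0 := by
  rw [resolventKE_apply, resolventRKE_of_not hL K h hσ]; rfl

/-- **Weak meaning of the even perturbed resolvent** (`Re σ > −m`): `resolventKE σ G = ofPair (ιEE p_R, ιEE p_I)` with
`(p_R, p_I) = pairOpKE σ (Re G, Im G)`, `Re/Im R⁺_K(σ)G = profile p_•` a.e., and the profiles solve the perturbed pair system with data
`(Re G, Im G)` on zero-mass even tests. [folklore] -/
theorem resolventKE_weak (hL : 0 < L) (K : EspE L hL →L[ℝ] W L) (h : GardingDataKE L hL d V K D₀ D₁ V₀ c m) {σ : ℂ} (hσ : -m < σ.re)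
    (G : Wc L) :
    resolventKE hL K h σ G = ofPair L (ιpairE hL (pairOpKE hL K h σ hσ (toPair L G))) ∧
      (((reW L (resolventKE hL K h σ G) : W L) : ℝ → ℝ) =ᵐ[volume] profile (pairOpKE hL K h σ hσ (toPair L G)).fst) ∧
      (((imW L (resolventKE hL K h σ G) : W L) : ℝ → ℝ) =ᵐ[volume] profile (pairOpKE hL K h σ hσ (toPair L G)).snd) ∧
      ∀ v v₁ : ℝ → ℝ, IsCompactTestE v v₁ → ∫ y, v y = 0 →
        linForm L d (fun ξ => V ξ + σ.re) (profile (pairOpKE hL K h σ hσ (toPair L G)).fst) (derE (pairOpKE hL K h σ hσ (toPair L G)).fst) v v₁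
              + (∫ y, (L ^ 2 + y ^ 2) * (((K (pairOpKE hL K h σ hσ (toPair L G)).fst : W L) : ℝ → ℝ) y * v y))
              - σ.im * ∫ y, (L ^ 2 + y ^ 2) * (profile (pairOpKE hL K h σ hσ (toPair L G)).snd y * v y) =
            ∫ y, (L ^ 2 + y ^ 2) * (((reW L G : W L) : ℝ → ℝ) y * v y) ∧
          linForm L d (fun ξ => V ξ + σ.re) (profile (pairOpKE hL K h σ hσ (toPair L G)).snd) (derE (pairOpKE hL K h σ hσ (toPair L G)).snd) v v₁
              + (∫ y, (L ^ 2 + y ^ 2) * (((K (pairOpKE hL K h σ hσ (toPair L G)).snd : W L) : ℝ → ℝ) y * v y))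
              + σ.im * ∫ y, (L ^ 2 + y ^ 2) * (profile (pairOpKE hL K h σ hσ (toPair L G)).fst y * v y) =
            ∫ y, (L ^ 2 + y ^ 2) * (((imW L G : W L) : ℝ → ℝ) y * v y) := by
  have happ : resolventKE hL K h σ G = ofPair L (ιpairE hL (pairOpKE hL K h σ hσ (toPair L G))) := by
    rw [resolventKE_apply, resolventRKE_apply hL K h hσ]
  set Q := pairOpKE hL K h σ hσ (toPair L G) with hQ
  have hpair : toPair L (resolventKE hL K h σ G) = ιpairE hL Q := by rw [happ, toPair_ofPair]
  obtain ⟨hc1, hc2⟩ := toPair_fst_snd (resolventKE hL K h σ G)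
  obtain ⟨hi1, hi2⟩ := ιpairE_fst_snd hL Q
  refine ⟨happ, ?_, ?_, fun v v₁ hv h0 => (pairOpKE_spec hL K h σ hσ).1 (toPair L G) v v₁ hv h0⟩
  · rw [← hc1, hpair, hi1]; exact ιEE_ae hL Q.fst
  · rw [← hc2, hpair, hi2]; exact ιEE_ae hL Q.snd

/-- **THE SHARP BOUND** `‖R⁺_K(σ)G‖ ≤ ‖G‖/(m + Re σ)` on the half-plane `Re σ > −m`. [folklore] -/
theorem norm_resolventKE_le_inv (hL : 0 < L) (K : EspE L hL →L[ℝ] W L) (h : GardingDataKE L hL d V K D₀ D₁ V₀ c m) {σ : ℂ}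
    (hσ : -m < σ.re) (G : Wc L) : ‖resolventKE hL K h σ G‖ ≤ ‖G‖ / (m + σ.re) := by
  have hc : 0 < m + σ.re := by linarith
  obtain ⟨happ, -, -, hweak⟩ := resolventKE_weak hL K h hσ G
  have hb := pair_pivot_le h hσ σ.im (pairOpKE hL K h σ hσ (toPair L G)) (toPair L G) hweak
  rw [norm_toPair] at hb
  rw [happ, norm_ofPair, le_div_iff₀ hc, mul_comm]
  exact hb

/-- The cruder operator-norm bound `‖R⁺_K(σ)G‖ ≤ (8/κ_c(σ))‖G‖`. [folklore] -/
theorem norm_resolventKE_le (hL : 0 < L) (K : EspE L hL →L[ℝ] W L) (h : GardingDataKE L hL d V K D₀ D₁ V₀ c m) {σ : ℂ} (hσ : -m < σ.re)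
    (G : Wc L) : ‖resolventKE hL K h σ G‖ ≤ 8 / min c (4 * (m + σ.re)) * ‖G‖ := by
  obtain ⟨happ, -, -, -⟩ := resolventKE_weak hL K h hσ G
  rw [happ, norm_ofPair]
  have h1 := (norm_ιpairE hL (pairOpKE hL K h σ hσ (toPair L G))).2
  have h2 := (pairOpKE_spec hL K h σ hσ).2 (toPair L G)
  rw [norm_toPair] at h2
  calc ‖ιpairE hL (pairOpKE hL K h σ hσ (toPair L G))‖ ≤ 2 * ‖pairOpKE hL K h σ hσ (toPair L G)‖ := h1
    _ ≤ 2 * (4 / min c (4 * (m + σ.re)) * ‖G‖) := by gcongr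
    _ = 8 / min c (4 * (m + σ.re)) * ‖G‖ := by ring

end SheetREvenResolvent
end Summit.NavierStokesRegularity.OSWSelfSimilar

end
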